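/-
Copyright: b2b-lace packet (explicit-unit carver, gen 19).  [FvdH17] §4.2 "Modified two-point functions": the
EXACT-LENGTH connection event `{v ←m̲→ x}` and `τ_{m̲,p}(x)` (the underlined indices of the paper), with the
one-step BK bound `τ_{m̲,p}(x) ≤ 2dp (D ⋆ τ_{m̲−1,p})(x)` of the second line of the display after (4.1).
Definitions and kernel lemmas only; no named fact; no numeral; no dimension is fixed.
-/
import Literature.Probability.FitznerVanDerHofstad2017.NobleBoundsN0
import HarnessLib

/-!
# [FvdH17] §4.2: the exact-length lines `{v ←m̲→ x}` and `τ_{m̲,p}`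

Source: R. Fitzner, R. van der Hofstad, *Mean-field behavior for nearest-neighbor percolation in `d > 10`*,
Electron. J. Probab. **22** (2017) no. 43 [FvdH17]; arXiv:1506.07977v2 §4.2 "Repulsive and simple diagrams —
Modified two-point functions" (v2 p. 34; EJP p. 31): "For `x, y ∈ ℤ^d`, `m ∈ ℕ`, we denote by `{x ←m→ y}` the event
that `x` is connected to `y` by a path of occupied, disjoint bonds `(b_i)_{i ≥ 1}` that consists of at least `m`
bonds. Further, we write `x ←m̲→ y` for the event that `x` and `y` are connected by a path of exactly `m` occupied
bonds. We define modified two-point functions for a lower index `j = m, m̲` by `τ_{j,p}(x) = P_p(0 ←j→ x)`, and note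
that, by the BK-inequality, `τ_{m,p}(x) ≤ 2dp (D ⋆ τ_{m−1,p})(x) ≤ (2dp)^m D^{⋆m} ⋆ τ_p (x)`,
`τ_{m̲,p}(x) ≤ 2dp (D ⋆ τ_{m̲−1,p})(x) ≤ (2dp)^m D^{⋆m}(x)`."

The companion module `NobleBoundsN0` types the "at least `m`" event `openConnGe m v x` under the PATH READING (the
open subgraph contains a vertex-simple path from `v` to `x` of length `≥ m`) and `τ_{m,p} = tauGe`.  This module adds,
under the same reading:
* `openConnEq m v x` — the open subgraph contains a vertex-simple path from `v` to `x` of length EXACTLY `m`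
  (`{v ←m̲→ x}`), with the finitary/increasing/measurable bookkeeping, `{v ←m̲→ x} ⊆ {v ←m→ x}`,
  `{v ←m→ x} = ⋃_{n ≥ m} {v ←n̲→ x}`, `{v ←m̲→ v} = ∅` for `m ≥ 1`, `{v ←0̲→ x} = ∅` for `v ≠ x`, relabelling;
* `tauEq d p m x = τ_{m̲,p}(x) = P_p(0 ←m̲→ x)` with `τ_{m̲,p} ≤ τ_{m,p} ≤ 1`, translation and lattice symmetry
  (`tauEq_stepVec : τ_{m̲,p}(e_ι) = τ_{m̲,p}(e₁)`);
* the first-bond decomposition `{v ←(m+1)̲→ x} ⊆ ⋃_u {(v,u) occupied} ∘ {u ←m̲→ x}`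
  (`openConnEq_succ_subset_iUnion_disjointOccurrence`) and, by `bk_finitary` and the one-bond marginal, the second
  line of the display: **`τ_{(m+1)̲,p}(x) ≤ Σ_{u ∼ 0} p · τ_{m̲,p}(x − u)`** (`= 2dp (D ⋆ τ_{m̲,p})(x)`, `D` the
  nearest-neighbour step distribution) — `tauEq_succ_le_sum_neighbor`.
* (rev 2, §A′/§B′) the LENGTH CLASSES behind the case split of the proof of Lemma 5.2 (§6.1, arXiv v2 p. 49: "We
  define `a = d_{C̃₀}(b̲₀,w)` and `b = d_{C̃₁(x)}(t,z)` … we split between several cases depending on the value of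
  `a`": Case `a = 0` / `a = 1` / `a ≥ 2`): `{v ←m→ x} = {v ←m̲→ x} ∪ {v ←(m+1)→ x}`
  (`openConnGe_eq_openConnEq_union_succ`), `ω ∈ {v ←0̲→ x} ↔ v = x`, `ω ∈ {v ←1̲→ x} ↔ v ≠ x ∧ (v,x) occupied`
  (the bond itself is the line), the cover `{v ↔ x} = {v ←0̲→ x} ∪ {v ←1̲→ x} ∪ {v ←2→ x}`
  (`openConn_eq_openConnEq_zero_union_one_union_openConnGe_two`) — a COVER by "there is an open simple path of length
  in the class" suffices for the union bound of §6.1 (each case is bounded separately and the bounds are added), the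
  finer partition by the intrinsic distance is not needed — and `τ_{m,p}(x) ≤ τ_{m̲,p}(x) + τ_{m+1,p}(x)`.
These are the letters with underlined indices of the building blocks of §5.1 / Appendix B (`B_{3,1̲}`, `T_{1,1̲,1}`,
`S_{1̲,0,2,1}`, …).  NOT in this module: the repulsive diagrams with exact-length lines (maxima over assignments of
lines to independent configurations, Def. 4.1), parity facts, and any numerical bound.

## References
* [FvdH17] arXiv:1506.07977v2 §4.2, display after (4.1) (v2 p. 34; EJP 22 (2017) no. 43 p. 31); §6.1, proof of
  Lemma 5.2, the case split by intrinsic distance (v2 p. 49; EJP p. 46).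
* [HvdH17] M. Heydenreich, R. van der Hofstad, *Progress in high-dimensional percolation and random graphs*, (7.2.10)
  (the one-step BK bound, typed for `{x ↔ y}` in `GaussianDominationRouteDiagrams.real_openConn_le_sum_neighbor`,
  whose proof is followed here).
-/

noncomputable section

namespace Literature.Probability.FitznerVanDerHofstad2017

open _root_.MeasureTheory Literature.Barriers.CriticalPhenomena Literature.Probability.Percolation
open Literature.Probability.LatticeModels
open scoped BigOperators ENNReal

local notation "𝐞" => Literature.Probability.Percolation.stepVec

/-! ### A. The event `{v ←m̲→ x}`

(The bookkeeping lemmas `isUpperSet_/isFinitary_/measurableSet_openConnEq` and `openConnEq_self_eq_empty` take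
their binders in the order `(v x) (m)`: with the order `(m) (v x)` the gate's restatement lint identifies them
shape-wise with the `openConnGe` lemmas of `NobleBoundsN0`, which concern a different event.) -/

section Events

variable {V W : Type*}

/-- **`{v ←m̲→ x}`** ([FvdH17] §4.2, text above (4.1), arXiv:1506.07977v2 p. 34): "`x` and `y` are connected by a
path of exactly `m` occupied bonds" — under the PATH READING of `NobleBoundsN0.openConnGe`: the open subgraph
contains a vertex-simple path from `v` to `x` of length `m`. [cite: FitznerVanDerHofstad2017, §4.2 (4.1) (arXiv:1506.07977v2 p. 34)] -/
def openConnEq (m : ℕ) (v x : V) : Set (BondConfig V) :=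
  {ω | ∃ w : (openGraph ω).Walk v x, w.IsPath ∧ w.length = m}

/-- Membership in `{v ←m̲→ x}` (definitional). [cite: FitznerVanDerHofstad2017, §4.2 (4.1) (arXiv:1506.07977v2 p. 34)] -/
theorem mem_openConnEq_iff (m : ℕ) (v x : V) (ω : BondConfig V) :
    ω ∈ openConnEq m v x ↔ ∃ w : (openGraph ω).Walk v x, w.IsPath ∧ w.length = m := Iff.rfl

/-- A configuration containing the edges of an open simple path of length `m` from `v` to `x` lies in
`{v ←m̲→ x}`. [folklore] -/
theorem mem_openConnEq_of_walk {ω : BondConfig V} {v x : V} (w : (openGraph ω).Walk v x) (hw : w.IsPath)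
    {m : ℕ} (hm : w.length = m) {K : Set (Sym2 V)} (hK : ∀ e ∈ w.edges, e ∈ K) : K ∈ openConnEq m v x :=
  ⟨w.transfer (openGraph K) (walk_edges_mem_edgeSet_openGraph w hK), hw.transfer _,
    by rw [SimpleGraph.Walk.length_transfer]; exact hm⟩

/-- `{v ←m̲→ x} ⊆ {v ←m→ x}`. [cite: FitznerVanDerHofstad2017, §4.2 (4.1) (arXiv:1506.07977v2 p. 34)] -/
theorem openConnEq_subset_openConnGe (m : ℕ) (v x : V) :
    (openConnEq m v x : Set (BondConfig V)) ⊆ openConnGe m v x :=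
  fun _ ⟨w, hw, hm⟩ => ⟨w, hw, hm.symm.le⟩

/-- `{v ←m→ x} = ⋃_{n ≥ m} {v ←n̲→ x}`. [cite: FitznerVanDerHofstad2017, §4.2 (4.1) (arXiv:1506.07977v2 p. 34)] -/
theorem openConnGe_eq_iUnion_openConnEq (m : ℕ) (v x : V) :
    (openConnGe m v x : Set (BondConfig V)) = ⋃ n, ⋃ (_ : m ≤ n), openConnEq n v x := by
  ext ω
  constructor
  · rintro ⟨w, hw, hm⟩
    exact Set.mem_iUnion₂.2 ⟨w.length, hm, w, hw, rfl⟩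
  · intro h
    obtain ⟨n, hn, w, hw, hl⟩ := Set.mem_iUnion₂.1 h
    exact ⟨w, hw, hn.trans_eq hl.symm⟩

/-- `{v ←m̲→ x}` is an increasing event. [folklore] -/
theorem isUpperSet_openConnEq (v x : V) (m : ℕ) : IsUpperSet (openConnEq m v x : Set (BondConfig V)) :=
  fun _ _ hle ⟨w, hw, hm⟩ => mem_openConnEq_of_walk w hw hm fun _ he => hle (mem_of_mem_walk_edges w he)

/-- `{v ←m̲→ x}` is finitary (witnessed by the edges of the path). [folklore] -/
theorem isFinitary_openConnEq [DecidableEq V] (v x : V) (m : ℕ) :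
    IsFinitary (openConnEq m v x : Set (BondConfig V)) := by
  rintro ω ⟨w, hw, hm⟩
  refine ⟨w.edges.toFinset, fun e he => mem_of_mem_walk_edges w (by simpa using he), ?_⟩
  exact mem_openConnEq_of_walk w hw hm fun e he => by simp [he]

/-- `{v ←m̲→ x}` is measurable (`V` countable). [folklore] -/
theorem measurableSet_openConnEq [Countable V] (v x : V) (m : ℕ) :
    MeasurableSet (openConnEq m v x : Set (BondConfig V)) := by
  classical
  exact (isFinitary_openConnEq v x m).measurableSet (isUpperSet_openConnEq v x m)

/-- `{v ←m̲→ v} = ∅` for `m ≥ 1` (a simple path from `v` to `v` is trivial). [folklore] -/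
theorem openConnEq_self_eq_empty (v : V) {m : ℕ} (hm : m ≠ 0) : (openConnEq m v v : Set (BondConfig V)) = ∅ :=
  Set.subset_eq_empty ((openConnEq_subset_openConnGe m v v).trans_eq (openConnGe_self_eq_empty hm v)) rfl

/-- `{v ←0̲→ x} = ∅` for `v ≠ x`. [folklore] -/
theorem openConnEq_zero_eq_empty {v x : V} (hvx : v ≠ x) : (openConnEq 0 v x : Set (BondConfig V)) = ∅ := by
  ext ω
  simp only [Set.mem_empty_iff_false, iff_false]
  rintro ⟨w, -, hw⟩
  exact hvx (SimpleGraph.Walk.eq_of_length_eq_zero hw)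

/-- `{v ←0̲→ v}` is the sure event. [folklore] -/
theorem openConnEq_zero_self (v : V) : (openConnEq 0 v v : Set (BondConfig V)) = Set.univ :=
  Set.eq_univ_of_forall fun _ => ⟨SimpleGraph.Walk.nil, SimpleGraph.Walk.IsPath.nil, rfl⟩

/-- Transport of `{v ←m̲→ x}` under a relabelling of the vertex set. [folklore] -/
theorem relabel_mem_openConnEq (φ : V ≃ W) {ω : BondConfig V} {m : ℕ} {v x : V} (h : ω ∈ openConnEq m v x) :
    BondConfig.relabel (sym2Equiv φ) ω ∈ openConnEq m (φ v) (φ x) := by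
  obtain ⟨w, hw, hm⟩ := h
  let f : openGraph ω →g openGraph (BondConfig.relabel (sym2Equiv φ) ω) :=
    (Literature.Barriers.CriticalPhenomena.openGraphRelabelIso φ ω : openGraph ω ≃g _)
  have hf : Function.Injective f := φ.injective
  refine ⟨w.map f, (SimpleGraph.Walk.isPath_map_iff_of_injective hf).2 hw, ?_⟩
  have hlen : (w.map f).length = w.length := SimpleGraph.Walk.length_map f w
  exact hlen.trans hm

/-- Transport of `{v ←m̲→ x}` under a relabelling of the vertex set (both directions). [folklore] -/
theorem relabel_mem_openConnEq_iff (φ : V ≃ W) (ω : BondConfig V) (m : ℕ) (v x : V) :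
    BondConfig.relabel (sym2Equiv φ) ω ∈ openConnEq m (φ v) (φ x) ↔ ω ∈ openConnEq m v x := by
  refine ⟨fun h => ?_, relabel_mem_openConnEq φ⟩
  have h' := relabel_mem_openConnEq φ.symm h
  simpa only [relabel_symm_relabel, Equiv.symm_apply_apply] using h'

/-- **First-bond decomposition**: `{v ←(m+1)̲→ x} ⊆ ⋃_u {(v,u) occupied} ∘ {u ←m̲→ x}` — the first bond of an
open simple path of length `m + 1` and the remaining path of length `m` are bond-disjoint witnesses ("by the
BK-inequality", the step behind `τ_{m̲,p}(x) ≤ 2dp (D ⋆ τ_{m̲−1,p})(x)`).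
[cite: FitznerVanDerHofstad2017, §4.2, display after (4.1) (arXiv:1506.07977v2 p. 34)] -/
theorem openConnEq_succ_subset_iUnion_disjointOccurrence (m : ℕ) (v x : V) :
    (openConnEq (m + 1) v x : Set (BondConfig V)) ⊆ ⋃ u : V, ({ω | s(v, u) ∈ ω} □ openConnEq m u x) := by
  rintro ω ⟨w, hw, hlen⟩
  cases w with
  | nil => exact absurd hlen (by simp)
  | @cons _ u _ hvu r =>
    refine Set.mem_iUnion.2 ⟨u, ?_⟩
    rw [(isUpperSet_edgeOpen (s(v, u))).mem_disjointOccurrence_iff (isUpperSet_openConnEq u x m)]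
    have hedge : s(v, u) ∈ ω := ((openGraph_adj ω v u).1 hvu).1
    have hr : r.IsPath := hw.of_cons
    have hrlen : r.length = m := by
      rw [SimpleGraph.Walk.length_cons] at hlen
      omega
    have hnotin : s(v, u) ∉ r.edges := by
      have hnd := hw.isTrail.edges_nodup
      rw [SimpleGraph.Walk.edges_cons, List.nodup_cons] at hnd
      exact hnd.1
    refine ⟨{s(v, u)}, by simpa using hedge, {f | f ∈ r.edges}, fun f hf => mem_of_mem_walk_edges r hf,
      ?_, by simp, ?_⟩
    · rw [Set.disjoint_singleton_left]
      exact hnotin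
    · exact mem_openConnEq_of_walk r hr hrlen fun f hf => hf

/-- **The one-step BK bound for exact-length lines on a graph**:
`P_p(v ←(m+1)̲→ x) ≤ Σ_{u ∼ v} p · P_p(u ←m̲→ x)` (union bound over the first bond, `bk_finitary`, one-bond
marginal; configurations using non-edges are null). [cite: FitznerVanDerHofstad2017, §4.2, display after (4.1) (arXiv:1506.07977v2 p. 34)] -/
theorem real_openConnEq_succ_le_sum_neighbor [DecidableEq V] [Countable V] (G : SimpleGraph V)
    [G.LocallyFinite] (p : unitInterval) (m : ℕ) (v x : V) :
    (bondPercolation G p).real (openConnEq (m + 1) v x) ≤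
      ∑ u ∈ G.neighborFinset v, (p : ℝ) * (bondPercolation G p).real (openConnEq m u x) := by
  set μ := bondPercolation G p with hμ
  set Z : Set (BondConfig V) := {ω | ¬ ω ⊆ G.edgeSet} with hZ
  have hZ0 : μ.real Z = 0 := by
    rw [measureReal_def, hμ, bondPercolation, hZ]
    rw [ae_iff.1 (ProbabilityTheory.setBernoulli_ae_subset (u := G.edgeSet) (p := p)),
      ENNReal.toReal_zero]
  have hsplit : (⋃ u : V, ({ω | s(v, u) ∈ ω} □ openConnEq m u x)) ⊆
      (⋃ u ∈ G.neighborFinset v, ({ω | s(v, u) ∈ ω} □ openConnEq m u x)) ∪ Z := by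
    intro ω hω
    obtain ⟨u, hu⟩ := Set.mem_iUnion.1 hω
    by_cases hvu : G.Adj v u
    · exact Or.inl (Set.mem_biUnion ((SimpleGraph.mem_neighborFinset G v u).2 hvu) hu)
    · refine Or.inr fun hωG => hvu ?_
      have h1 : s(v, u) ∈ ω := (disjointOccurrence_subset_inter _ _ hu).1
      simpa using hωG h1
  calc μ.real (openConnEq (m + 1) v x) ≤ μ.real (⋃ u : V, ({ω | s(v, u) ∈ ω} □ openConnEq m u x)) :=
        measureReal_mono (openConnEq_succ_subset_iUnion_disjointOccurrence m v x)
    _ ≤ μ.real ((⋃ u ∈ G.neighborFinset v, ({ω | s(v, u) ∈ ω} □ openConnEq m u x)) ∪ Z) :=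
        measureReal_mono hsplit
    _ ≤ μ.real (⋃ u ∈ G.neighborFinset v, ({ω | s(v, u) ∈ ω} □ openConnEq m u x)) + μ.real Z :=
        measureReal_union_le _ _
    _ ≤ ∑ u ∈ G.neighborFinset v, μ.real ({ω | s(v, u) ∈ ω} □ openConnEq m u x) + 0 := by
        rw [hZ0]
        exact add_le_add (measureReal_biUnion_finset_le _ _) le_rfl
    _ = ∑ u ∈ G.neighborFinset v, μ.real ({ω | s(v, u) ∈ ω} □ openConnEq m u x) := add_zero _
    _ ≤ ∑ u ∈ G.neighborFinset v, (p : ℝ) * μ.real (openConnEq m u x) := by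
        refine Finset.sum_le_sum fun u hu => ?_
        rw [SimpleGraph.mem_neighborFinset] at hu
        calc μ.real ({ω | s(v, u) ∈ ω} □ openConnEq m u x)
            ≤ μ.real {ω : BondConfig V | s(v, u) ∈ ω} * μ.real (openConnEq m u x) :=
              bk_finitary G p (isUpperSet_edgeOpen _) (isUpperSet_openConnEq u x m)
                (isFinitary_edgeOpen _) (isFinitary_openConnEq u x m)
          _ = (p : ℝ) * μ.real (openConnEq m u x) := by
              rw [hμ, bondPercolation_cylinder G p ((SimpleGraph.mem_edgeSet G).2 hu)]

/-! ### A′. Length classes (the case split `a = 0 / a = 1 / a ≥ 2` of [FvdH17] §6.1) -/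

/-- `{v ←m→ x} = {v ←m̲→ x} ∪ {v ←(m+1)→ x}`: an open simple path of length `≥ m` has length `m` or `≥ m + 1`.
[cite: FitznerVanDerHofstad2017, §6.1, proof of Lemma 5.2, case split "a = 0 / a = 1 / a ≥ 2" (arXiv:1506.07977v2 p. 49)] -/
theorem openConnGe_eq_openConnEq_union_succ (v x : V) (m : ℕ) :
    (openConnGe m v x : Set (BondConfig V)) = openConnEq m v x ∪ openConnGe (m + 1) v x := by
  ext ω
  constructor
  · rintro ⟨w, hw, hm⟩
    rcases hm.eq_or_lt with h | h
    · exact Or.inl ⟨w, hw, h.symm⟩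
    · exact Or.inr ⟨w, hw, h⟩
  · rintro (⟨w, hw, hm⟩ | ⟨w, hw, hm⟩)
    · exact ⟨w, hw, hm.symm.le⟩
    · exact ⟨w, hw, (Nat.le_succ m).trans hm⟩

/-- `{v ←m̲→ x} ⊆ {v ←m→ x}` and `{v ←(m+1)→ x} ⊆ {v ←m→ x}` cover `{v ←m→ x}` — membership form.
[cite: FitznerVanDerHofstad2017, §6.1, proof of Lemma 5.2 (arXiv:1506.07977v2 p. 49)] -/
theorem mem_openConnEq_or_mem_openConnGe_succ {v x : V} {m : ℕ} {ω : BondConfig V}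
    (h : ω ∈ (openConnGe m v x : Set (BondConfig V))) :
    ω ∈ openConnEq m v x ∨ ω ∈ (openConnGe (m + 1) v x : Set (BondConfig V)) := by
  rw [openConnGe_eq_openConnEq_union_succ] at h
  exact h

/-- Case `a = 0`: `ω ∈ {v ←0̲→ x} ↔ v = x` ("In this case `w = u`").
[cite: FitznerVanDerHofstad2017, §6.1, proof of Lemma 5.2, "Case a = 0" (arXiv:1506.07977v2 p. 49)] -/
theorem mem_openConnEq_zero_iff (v x : V) (ω : BondConfig V) : ω ∈ openConnEq 0 v x ↔ v = x := by
  constructor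
  · rintro ⟨w, -, hlen⟩
    exact SimpleGraph.Walk.eq_of_length_eq_zero hlen
  · rintro rfl
    exact ⟨SimpleGraph.Walk.nil, SimpleGraph.Walk.IsPath.nil, rfl⟩

/-- Case `a = 1`: `ω ∈ {v ←1̲→ x} ↔ v ≠ x ∧ (v,x) ∈ ω` ("`u` and `w` are neighbors, … the bond `{u,w}` is
occupied": the bond itself is the exact-length-`1` line).
[cite: FitznerVanDerHofstad2017, §6.1, proof of Lemma 5.2, "Case a = 1" (arXiv:1506.07977v2 p. 49)] -/
theorem mem_openConnEq_one_iff (v x : V) (ω : BondConfig V) : ω ∈ openConnEq 1 v x ↔ v ≠ x ∧ s(v, x) ∈ ω := by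
  constructor
  · rintro ⟨w, -, hlen⟩
    have hadj : (openGraph ω).Adj v x := SimpleGraph.Walk.adj_of_length_eq_one hlen
    exact ⟨hadj.ne, ((openGraph_adj ω v x).1 hadj).1⟩
  · rintro ⟨hne, he⟩
    have hadj : (openGraph ω).Adj v x := (openGraph_adj ω v x).2 ⟨he, hne⟩
    refine ⟨hadj.toWalk, ?_, by simp⟩
    exact (SimpleGraph.Walk.cons_isPath_iff _ _).2 ⟨SimpleGraph.Walk.IsPath.nil, by simpa using hne⟩

/-- On a subgraph of a simple graph `G` (lattice configurations `ω ⊆ E(G)`), `{v ←1̲→ x}` forces `v ∼ x` in `G`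
("`2dD(u-w) = 1`"). [cite: FitznerVanDerHofstad2017, §6.1, proof of Lemma 5.2, "Case a = 1" (arXiv:1506.07977v2 p. 49)] -/
theorem adj_of_mem_openConnEq_one {G : SimpleGraph V} {ω : BondConfig V} (hω : ω ⊆ G.edgeSet) {v x : V}
    (h : ω ∈ openConnEq 1 v x) : G.Adj v x := by
  obtain ⟨-, he⟩ := (mem_openConnEq_one_iff v x ω).1 h
  exact (SimpleGraph.mem_edgeSet G).1 (hω he)

/-- The cover behind the three cases: `{v ↔ x} = {v ←0̲→ x} ∪ {v ←1̲→ x} ∪ {v ←2→ x}` (under the path reading an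
open connection is witnessed by a simple path of length `0`, `1` or `≥ 2`; for the union bound of §6.1 this cover —
rather than the partition by the intrinsic distance — is all that is used).
[cite: FitznerVanDerHofstad2017, §6.1, proof of Lemma 5.2, "Case a = 0 / a = 1 / a ≥ 2" (arXiv:1506.07977v2 p. 49)] -/
theorem openConn_eq_openConnEq_zero_union_one_union_openConnGe_two (v x : V) :
    (openConn v x : Set (BondConfig V)) = openConnEq 0 v x ∪ openConnEq 1 v x ∪ openConnGe 2 v x := by
  rw [← openConnGe_zero, openConnGe_eq_openConnEq_union_succ v x 0, openConnGe_eq_openConnEq_union_succ v x 1,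
    Set.union_assoc]

/-- Case `a ≥ 2` isolated: an open connection between distinct sites whose bond is NOT occupied is witnessed by a
simple path of length `≥ 2`. [cite: FitznerVanDerHofstad2017, §6.1, proof of Lemma 5.2, "Case a ≥ 2" (arXiv:1506.07977v2 p. 49)] -/
theorem mem_openConnGe_two_of_mem_openConn {v x : V} {ω : BondConfig V} (h : ω ∈ (openConn v x : Set (BondConfig V)))
    (hvx : v ≠ x) (he : s(v, x) ∉ ω) : ω ∈ (openConnGe 2 v x : Set (BondConfig V)) := by
  rw [openConn_eq_openConnEq_zero_union_one_union_openConnGe_two] at h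
  rcases h with (h0 | h1) | h2
  · exact absurd ((mem_openConnEq_zero_iff v x ω).1 h0) hvx
  · exact absurd ((mem_openConnEq_one_iff v x ω).1 h1).2 he
  · exact h2

end Events

/-! ### B. `τ_{m̲,p}` on `ℤ^d` -/

section Lattice

variable {d : ℕ}

/-- **`τ_{m̲,p}(x) = P_p(0 ←m̲→ x)`** ([FvdH17] (4.1) with the underlined lower index, arXiv:1506.07977v2 p. 34;
EJP p. 31), under the PATH READING. [cite: FitznerVanDerHofstad2017, §4.2 (4.1) (arXiv:1506.07977v2 p. 34)] -/
def tauEq (d : ℕ) (p : unitInterval) (m : ℕ) (x : Site d) : ℝ :=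
  (bondPercolation (zdGraph d) p).real (openConnEq m 0 x)

/-- `τ_{m̲,p} ≥ 0`. [folklore] -/
theorem tauEq_nonneg (p : unitInterval) (m : ℕ) (x : Site d) : 0 ≤ tauEq d p m x := measureReal_nonneg

/-- `τ_{m̲,p}(x) ≤ τ_{m,p}(x)`. [cite: FitznerVanDerHofstad2017, §4.2 (4.1) (arXiv:1506.07977v2 p. 34)] -/
theorem tauEq_le_tauGe (p : unitInterval) (m : ℕ) (x : Site d) : tauEq d p m x ≤ tauGe d p m x :=
  measureReal_mono (openConnEq_subset_openConnGe m 0 x)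

/-- `τ_{m̲,p}(x) ≤ 1`. [folklore] -/
theorem tauEq_le_one (p : unitInterval) (m : ℕ) (x : Site d) : tauEq d p m x ≤ 1 :=
  (tauEq_le_tauGe p m x).trans (tauGe_le_one p m x)

/-- `τ_{m̲,p}(0) = 0` for `m ≥ 1`. [cite: FitznerVanDerHofstad2017, §4.2 (4.1) (arXiv:1506.07977v2 p. 34)] -/
theorem tauEq_zero_of_ne (p : unitInterval) {m : ℕ} (hm : m ≠ 0) : tauEq d p m 0 = 0 := by
  simp [tauEq, openConnEq_self_eq_empty (0 : Site d) hm]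

/-- `τ_{0̲,p}(x) = 0` for `x ≠ 0` and `τ_{0̲,p}(0) = 1`. [folklore] -/
theorem tauEq_zero_eq (p : unitInterval) (x : Site d) : tauEq d p 0 x = if x = 0 then 1 else 0 := by
  unfold tauEq
  split_ifs with hx
  · subst hx
    rw [openConnEq_zero_self]
    simp
  · rw [openConnEq_zero_eq_empty (Ne.symm hx)]
    simp

/-- Transport of `P_p(v ←m̲→ x)` under a lattice automorphism. [folklore] -/
theorem measure_openConnEq_iso (φ : zdGraph d ≃g zdGraph d) (p : unitInterval) (m : ℕ) (v x : Site d) :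
    bondPercolation (zdGraph d) p (openConnEq m (φ v) (φ x)) = bondPercolation (zdGraph d) p (openConnEq m v x) := by
  have h := measure_setOf_relabel φ p (P := fun ζ => ζ ∈ openConnEq m v x)
    (P' := fun ζ => ζ ∈ openConnEq m (φ v) (φ x)) (fun ζ => relabel_mem_openConnEq_iff φ.toEquiv ζ m v x)
  simpa only [Set.setOf_mem_eq] using h

/-- `τ_{m̲,p}(φ x) = τ_{m̲,p}(x)` for a lattice automorphism fixing the origin. [folklore] -/
theorem tauEq_iso (φ : zdGraph d ≃g zdGraph d) (hφ : φ 0 = 0) (p : unitInterval) (m : ℕ) (x : Site d) :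
    tauEq d p m (φ x) = tauEq d p m x := by
  unfold tauEq
  have h := measure_openConnEq_iso φ p m 0 x
  rw [hφ] at h
  simp only [measureReal_def, h]

/-- `P_p(v ←m̲→ x) = τ_{m̲,p}(x − v)` (translation invariance). [folklore] -/
theorem measureReal_openConnEq_eq_tauEq (p : unitInterval) (m : ℕ) (v x : Site d) :
    (bondPercolation (zdGraph d) p).real (openConnEq m v x) = tauEq d p m (x - v) := by
  unfold tauEq
  have h := measure_openConnEq_iso (zdShiftIso (-v)) p m v x
  simp only [zdShiftIso_apply, add_neg_cancel, ← sub_eq_add_neg] at h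
  simp only [measureReal_def, h]

/-- `τ_{m̲,p}(e_ι) = τ_{m̲,p}(e₁)` for every unit step `e_ι` (signed-permutation symmetry).
[cite: FitznerVanDerHofstad2017, §4.2 (4.1) (arXiv:1506.07977v2 p. 34)] -/
theorem tauEq_stepVec (hd : 1 ≤ d) (p : unitInterval) (m : ℕ) (ι : Fin d × Bool) :
    tauEq d p m (𝐞 ι) = tauEq d p m (unitSite1 d) := by
  have he1 : unitSite1 d = 𝐞 ((⟨0, hd⟩ : Fin d), true) := by
    rw [unitSite1_eq_single hd, stepVec_eq_single]
    simp
  obtain ⟨π, ε, hπ⟩ := exists_signedPerm_stepVec ((⟨0, hd⟩ : Fin d), true) ι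
  rw [he1, ← hπ]
  have h := tauEq_iso (zdSignedPermIso π ε) (by simp) p m (𝐞 ((⟨0, hd⟩ : Fin d), true))
  simpa only [zdSignedPermIso_apply] using h

/-- **`τ_{(m+1)̲,p}(x) ≤ Σ_{u ∼ 0} p · τ_{m̲,p}(x − u) = 2dp (D ⋆ τ_{m̲,p})(x)`** — the second line of the display
after (4.1) ("by the BK-inequality … `τ_{m̲,p}(x) ≤ 2dp (D ⋆ τ_{m̲−1,p})(x)`"), `D` the nearest-neighbour step
distribution, the sum running over the `2d` neighbours `u` of the origin.
[cite: FitznerVanDerHofstad2017, §4.2, display after (4.1) (arXiv:1506.07977v2 p. 34)] -/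
theorem tauEq_succ_le_sum_neighbor (p : unitInterval) (m : ℕ) (x : Site d) :
    tauEq d p (m + 1) x ≤ ∑ u ∈ (zdGraph d).neighborFinset 0, (p : ℝ) * tauEq d p m (x - u) := by
  classical
  have h := real_openConnEq_succ_le_sum_neighbor (zdGraph d) p m 0 x
  simp only [measureReal_openConnEq_eq_tauEq, sub_zero] at h
  exact h

/-- Iterating: `τ_{m̲,p}(x) ≤ 1` and the one-step bound give `τ_{(m+1)̲,p}(x) ≤ Σ_{u ∼ 0} p` (a crude corollary,
the shape `(2dp)^m` of the display's last inequality at its first step). [cite: FitznerVanDerHofstad2017, §4.2, display after (4.1) (arXiv:1506.07977v2 p. 34)] -/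
theorem tauEq_succ_le_sum_p (p : unitInterval) (m : ℕ) (x : Site d) :
    tauEq d p (m + 1) x ≤ ∑ _u ∈ (zdGraph d).neighborFinset 0, (p : ℝ) :=
  (tauEq_succ_le_sum_neighbor p m x).trans
    (Finset.sum_le_sum fun _ _ => mul_le_of_le_one_right p.2.1 (tauEq_le_one p m _))

/-! ### B′. `τ_{m,p} ≤ τ_{m̲,p} + τ_{m+1,p}` -/

/-- The union bound over the length classes: `τ_{m,p}(x) ≤ τ_{m̲,p}(x) + τ_{m+1,p}(x)`.
[cite: FitznerVanDerHofstad2017, §6.1, proof of Lemma 5.2, case split (arXiv:1506.07977v2 p. 49)] -/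
theorem tauGe_le_tauEq_add_tauGe_succ (p : unitInterval) (m : ℕ) (x : Site d) :
    tauGe d p m x ≤ tauEq d p m x + tauGe d p (m + 1) x := by
  unfold tauGe tauEq
  rw [openConnGe_eq_openConnEq_union_succ (0 : Site d) x m]
  exact measureReal_union_le _ _

end Lattice

end Literature.Probability.FitznerVanDerHofstad2017

end
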